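import Mathlib.CategoryTheory.Galois.Topology
import Mathlib.CategoryTheory.Galois.Prorepresentability
import Mathlib.CategoryTheory.Comma.Over.Pullback
import Mathlib.CategoryTheory.Limits.Constructions.Over.Connected
import Mathlib.Topology.Algebra.MulAction
import Literature.AnabelianGeometry.Anabelioids.Basic
import Literature.AnabelianGeometry.Anabelioids.TrivialObjectFibre
import HarnessLib

/-!
# Anabelioids: the local dictionary of a finite étale morphism, II — lifting the stabiliser

Mochizuki, *The geometry of anabelioids*, Publ. RIMS **40** (2004), §1.2, Def. 1.2.2 (i), Remark
1.2.2.1 p. 17 [cite: MochizukiGeoAn2004, Rem. 1.2.2.1 p.17]; *Semi-graphs of anabelioids*, Publ.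
RIMS **42** (2006), Remark 2.2.1 p. 24 ("the stabilizers in `Π_𝒢`")
[cite: MochizukiSemiAnbd2006, Rem. 2.2.1 p.24].

PROOF-ONLY infrastructure (abc-iut L3 row `L3:FiniteEtaleLocalDictionary`, part 2, L6-t17).
Over an object `S` of a category with binary products, for a functor `F₁ : C_{/S} ⥤ FintypeCat`
preserving pullbacks (e.g. a basepoint of `C_{/S}` transported along an equivalence):

* `isPullback_lift_id_diag`, `unit_comp_star_map`, `isPullback_unit` — the unit `U ⟶ S × U` of
  `forget ⊣ star` is the pull-back of `S × u : S × U → S × S` along the diagonal `(S = S) → S × S`;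
* `exists_preimage_unit_iff` — hence the image of `F₁(U) ↪ F₁(S × U)` is EXACTLY the fibre of
  `F₁(S × u)` over the base point (the image of the one-point fibre `F₁(S = S)`).

* `exists_aut_pi1Map_star_eq` — **the lift**: every automorphism `τ` of the basepoint
  `(S × −) ⋙ F₁` of `C` FIXING the base point is `π₁(i_S)(σ)` for an automorphism `σ` of `F₁`
  (`σ_U` = the restriction of `τ_U` to `F₁(U) ↪ F₁(S × U)`; naturality from that of the unit and of
  `τ`; `π₁(i_S)(σ) = τ` by the triangle identity `(S × U ⟶ S × (S × U)) ≫ (S × pr₂) = 1`).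

This is the "⊇" half of "`Π_{v'}` = the stabiliser of a pro-vertex" ([SemiAnbd] Rem. 2.2.1) in the
core case `D = C_{/S}`; the transport to an arbitrary finite étale `Q ≅ (S × −) ⋙ α` (α an
equivalence) is bookkeeping on `Aut` along `α` and `e` (sequel file).
-/

namespace Literature.AnabelianGeometry.Anabelioids

open CategoryTheory CategoryTheory.Limits CategoryTheory.Functor CategoryTheory.PreGaloisCategory

universe w u₁ u₂

section Graph

variable {C : Type u₁} [Category.{u₂} C] [HasBinaryProducts C] {S : C}

/-- The graph `(u, 1) : X → S × X` of `u : X → S` is the pull-back of `S × u` along the diagonal of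
`S`. [cite: MochizukiGeoAn2004, Def. 1.2.2(i) p.17] -/
theorem isPullback_lift_id_diag {X : C} (u : X ⟶ S) :
    IsPullback (prod.lift u (𝟙 X)) u (prod.map (𝟙 S) u) (prod.lift (𝟙 S) (𝟙 S)) := by
  refine IsPullback.of_isLimit' ⟨by ext <;> simp⟩
    (PullbackCone.IsLimit.mk _ (fun s => s.fst ≫ prod.snd) ?_ ?_ ?_)
  · intro s
    have h1 : s.fst ≫ prod.fst = s.snd := by
      have := congrArg (· ≫ prod.fst) s.condition
      simp only [Category.assoc, prod.map_fst, Category.comp_id, prod.lift_fst] at this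
      exact this
    have h2 : s.fst ≫ prod.snd ≫ u = s.snd := by
      have := congrArg (· ≫ prod.snd) s.condition
      simp only [Category.assoc, prod.map_snd, Category.comp_id, prod.lift_snd] at this
      exact this
    apply Limits.prod.hom_ext
    · simp only [Category.assoc, prod.lift_fst]
      rw [h2, h1]
    · simp only [Category.assoc, prod.lift_snd, Category.comp_id]
  · intro s
    have h2 : s.fst ≫ prod.snd ≫ u = s.snd := by
      have := congrArg (· ≫ prod.snd) s.condition
      simp only [Category.assoc, prod.map_snd, Category.comp_id, prod.lift_snd] at this
      exact this
    rw [Category.assoc]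
    exact h2
  · intro s m hm1 _
    have := congrArg (· ≫ prod.snd) hm1
    simp only [Category.assoc, prod.lift_snd, Category.comp_id] at this
    exact this

/-- The unit square: `(U ⟶ S × U) ≫ (S × u) = (U ⟶ (S = S)) ≫ ((S = S) ⟶ S × S)` in `C_{/S}`
(naturality of the unit of `forget ⊣ star` at `U ⟶ (S = S)`). [cite: MochizukiGeoAn2004, Def. 1.2.2(i) p.17] -/
theorem unit_comp_star_map (U : Over S) :
    (Over.forgetAdjStar S).unit.app U ≫ (Over.star S).map U.hom =
      (Over.homMk U.hom (Category.comp_id _) : U ⟶ Over.mk (𝟙 S)) ≫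
        (Over.forgetAdjStar S).unit.app (Over.mk (𝟙 S)) := by
  have h := (Over.forgetAdjStar S).unit.naturality
    (Over.homMk U.hom (Category.comp_id _) : U ⟶ Over.mk (𝟙 S))
  exact h.symm

/-- The unit `U ⟶ S × U` is the pull-back, in `C_{/S}`, of `S × u : S × U → S × S` along the
diagonal `(S = S) → S × S` (the forgetful functor to `C` creates connected limits, and on underlying
objects this is `isPullback_lift_id_diag`). [cite: MochizukiGeoAn2004, Def. 1.2.2(i) p.17] -/
theorem isPullback_unit (U : Over S) :
    IsPullback ((Over.forgetAdjStar S).unit.app U) (Over.homMk U.hom (Category.comp_id _) : U ⟶ Over.mk (𝟙 S))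
      ((Over.star S).map U.hom) ((Over.forgetAdjStar S).unit.app (Over.mk (𝟙 S))) := by
  refine IsPullback.of_map (Over.forget S) (unit_comp_star_map U) ?_
  simp only [Over.forget_map, Over.forgetAdjStar_unit_app_left, Over.homMk_left, Over.star_map_left,
    Over.mk_hom]
  exact isPullback_lift_id_diag U.hom

end Graph

section Image

variable {C : Type u₁} [Category.{u₂} C] [HasBinaryProducts C] {S : C}
  (F₁ : Over S ⥤ FintypeCat.{w}) [PreservesLimitsOfShape WalkingCospan F₁]

/-- **Image of `F₁(U) → F₁(S × U)` = fibre over the base point.** For a functor `F₁` on `C_{/S}`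
preserving pull-backs and with one-point fibre at `S = S` (point `t`), an element `y ∈ F₁(S × U)`
comes from `F₁(U)` iff `F₁(S × u)(y)` is the base point `F₁(Δ)(t) ∈ F₁(S × S)`.
[cite: MochizukiSemiAnbd2006, Rem. 2.2.1 p.24] -/
theorem exists_preimage_unit_iff [Subsingleton (F₁.obj (Over.mk (𝟙 S)))]
    (t : F₁.obj (Over.mk (𝟙 S))) (U : Over S) (y : F₁.obj ((Over.star S).obj U.left)) :
    (∃ x : F₁.obj U, F₁.map ((Over.forgetAdjStar S).unit.app U) x = y) ↔
      F₁.map ((Over.star S).map U.hom) y =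
        F₁.map ((Over.forgetAdjStar S).unit.app (Over.mk (𝟙 S))) t := by
  constructor
  · rintro ⟨x, rfl⟩
    have key0 : F₁.map ((Over.forgetAdjStar S).unit.app U) ≫ F₁.map ((Over.star S).map U.hom) =
        F₁.map (Over.homMk U.hom (Category.comp_id _) : U ⟶ Over.mk (𝟙 S)) ≫
          F₁.map ((Over.forgetAdjStar S).unit.app (Over.mk (𝟙 S))) :=
      (F₁.map_comp _ _).symm.trans ((congrArg F₁.map (unit_comp_star_map U)).trans (F₁.map_comp _ _))
    have key := ConcreteCategory.congr_hom key0 x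
    have ht : F₁.map (Over.homMk U.hom (Category.comp_id _) : U ⟶ Over.mk (𝟙 S)) x = t :=
      Subsingleton.elim _ _
    calc F₁.map ((Over.star S).map U.hom) (F₁.map ((Over.forgetAdjStar S).unit.app U) x)
        = (F₁.map ((Over.forgetAdjStar S).unit.app U) ≫ F₁.map ((Over.star S).map U.hom)) x := rfl
      _ = (F₁.map (Over.homMk U.hom (Category.comp_id _) : U ⟶ Over.mk (𝟙 S)) ≫
            F₁.map ((Over.forgetAdjStar S).unit.app (Over.mk (𝟙 S)))) x := key
      _ = F₁.map ((Over.forgetAdjStar S).unit.app (Over.mk (𝟙 S)))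
            (F₁.map (Over.homMk U.hom (Category.comp_id _) : U ⟶ Over.mk (𝟙 S)) x) := rfl
      _ = F₁.map ((Over.forgetAdjStar S).unit.app (Over.mk (𝟙 S))) t := by rw [ht]
  · intro hy
    have sq := (isPullback_unit U).map F₁
    let py : FintypeCat.of PUnit.{w + 1} ⟶ F₁.obj ((Over.star S).obj U.left) :=
      FintypeCat.homMk fun _ => y
    let pt : FintypeCat.of PUnit.{w + 1} ⟶ F₁.obj (Over.mk (𝟙 S)) := FintypeCat.homMk fun _ => t
    have hw : py ≫ F₁.map ((Over.star S).map U.hom) =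
        pt ≫ F₁.map ((Over.forgetAdjStar S).unit.app (Over.mk (𝟙 S))) := by
      ext ⟨⟩
      exact hy
    refine ⟨sq.lift py pt hw PUnit.unit, ?_⟩
    exact congrArg (fun f : FintypeCat.of PUnit.{w + 1} ⟶ _ => f PUnit.unit) (sq.lift_fst py pt hw)

end Image

section Lift

variable {C : Type u₁} [Category.{u₂} C] [HasBinaryProducts C] {S : C}
  (F₁ : Over S ⥤ FintypeCat.{w}) [PreservesLimitsOfShape WalkingCospan F₁] [F₁.PreservesMonomorphisms]

omit [PreservesLimitsOfShape WalkingCospan F₁] in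
/-- `F₁(U) → F₁(S × U)` is injective for `F₁` preserving monomorphisms (the unit `U ⟶ S × U` is a
monomorphism: its underlying map is split by the second projection).
[cite: MochizukiGeoAn2004, Def. 1.2.2(i) p.17] -/
theorem map_unit_injective (U : Over S) :
    Function.Injective (F₁.map ((Over.forgetAdjStar S).unit.app U)) := by
  haveI : IsSplitMono ((Over.forgetAdjStar S).unit.app U).left :=
    IsSplitMono.mk' ⟨prod.snd, by rw [Over.forgetAdjStar_unit_app_left]; exact prod.lift_snd _ _⟩
  haveI : Mono ((Over.forgetAdjStar S).unit.app U) := Over.mono_of_mono_left _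
  haveI : Mono (F₁.map ((Over.forgetAdjStar S).unit.app U)) := inferInstance
  exact ConcreteCategory.injective_of_mono_of_preservesPullback _

/-- **Lifting the stabiliser (core case `D = C_{/S}`, `Q = S × −`).** Let `F₁` be a functor on
`C_{/S}` preserving pull-backs and monomorphisms, with one-point fibre at `S = S` (point `t`). Every
automorphism `τ` of the basepoint `(S × −) ⋙ F₁` of `C` which FIXES the base point
`F₁(Δ)(t) ∈ F₁(S × S)` is the whiskering `π₁(i_S)(σ)` of an automorphism `σ` of `F₁`: on `F₁(U)`,
embedded in `F₁(S × U)` as the fibre of `F₁(S × u)` over the base point (`exists_preimage_unit_iff`),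
`σ_U` is the restriction of `τ_U`. This is the "⊇" half of "`Π_{v'}` = the stabiliser of a
pro-vertex" ([SemiAnbd] Rem. 2.2.1) / of [GeoAn] Rem. 1.2.2.1.
[cite: MochizukiSemiAnbd2006, Rem. 2.2.1 p.24] -/
theorem exists_aut_pi1Map_star_eq [Subsingleton (F₁.obj (Over.mk (𝟙 S)))]
    (t : F₁.obj (Over.mk (𝟙 S))) (τ : Aut (Over.star S ⋙ F₁))
    (hτ : τ.hom.app S (F₁.map ((Over.forgetAdjStar S).unit.app (Over.mk (𝟙 S))) t) =
      F₁.map ((Over.forgetAdjStar S).unit.app (Over.mk (𝟙 S))) t) :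
    ∃ σ : Aut F₁, pi1Map (Over.star S) F₁ σ = τ := by
  classical
  -- naturality of the unit `η`, applied: `F₁(η_V)(F₁ f x) = F₁(S × f)(F₁(η_U) x)`
  have hη_nat : ∀ {U V : Over S} (f : U ⟶ V) (x : F₁.obj U),
      F₁.map ((Over.forgetAdjStar S).unit.app V) (F₁.map f x) =
        F₁.map ((Over.star S).map f.left) (F₁.map ((Over.forgetAdjStar S).unit.app U) x) := by
    intro U V f x
    have h0 : F₁.map f ≫ F₁.map ((Over.forgetAdjStar S).unit.app V) =
        F₁.map ((Over.forgetAdjStar S).unit.app U) ≫ F₁.map ((Over.star S).map f.left) :=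
      (F₁.map_comp _ _).symm.trans
        ((congrArg F₁.map ((Over.forgetAdjStar S).unit.naturality f)).trans (F₁.map_comp _ _))
    exact ConcreteCategory.congr_hom h0 x
  -- naturality of `τ`, applied
  have hτ_nat : ∀ {A B : C} (f : A ⟶ B) (y : F₁.obj ((Over.star S).obj A)),
      τ.hom.app B (F₁.map ((Over.star S).map f) y) =
        F₁.map ((Over.star S).map f) (τ.hom.app A y) := by
    intro A B f y
    exact ConcreteCategory.congr_hom (τ.hom.naturality f) y
  have himg := exists_preimage_unit_iff F₁ t
  -- `τ_{U}` maps the image of `F₁(U) ↪ F₁(S × U)` into itself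
  have hP : ∀ (U : Over S) (x : F₁.obj U), ∃ x' : F₁.obj U,
      F₁.map ((Over.forgetAdjStar S).unit.app U) x' =
        τ.hom.app U.left (F₁.map ((Over.forgetAdjStar S).unit.app U) x) := by
    intro U x
    refine (himg U _).mpr ?_
    rw [← hτ_nat U.hom, (himg U _).mp ⟨x, rfl⟩]
    exact hτ
  have hg : ∀ (U : Over S) (x : F₁.obj U),
      F₁.map ((Over.forgetAdjStar S).unit.app U) (Classical.choose (hP U x)) =
        τ.hom.app U.left (F₁.map ((Over.forgetAdjStar S).unit.app U) x) :=
    fun U x => Classical.choose_spec (hP U x)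
  have hτ_inj : ∀ A : C, Function.Injective (τ.hom.app A) := fun A =>
    (FintypeCat.equivEquivIso.symm (τ.app A)).injective
  have hg_inj : ∀ U : Over S, Function.Injective (fun x => Classical.choose (hP U x)) := by
    intro U x₁ x₂ h
    apply map_unit_injective F₁ U
    apply hτ_inj U.left
    rw [← hg U x₁, ← hg U x₂]
    exact congrArg _ h
  have hg_bij : ∀ U : Over S, Function.Bijective (fun x => Classical.choose (hP U x)) := fun U =>
    Finite.injective_iff_bijective.mp (hg_inj U)
  -- naturality of the components
  have σnat : ∀ {U V : Over S} (f : U ⟶ V),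
      F₁.map f ≫ (FintypeCat.equivEquivIso (Equiv.ofBijective _ (hg_bij V))).hom =
        (FintypeCat.equivEquivIso (Equiv.ofBijective _ (hg_bij U))).hom ≫ F₁.map f := by
    intro U V f
    ext x
    show Classical.choose (hP V (F₁.map f x)) = F₁.map f (Classical.choose (hP U x))
    apply map_unit_injective F₁ V
    exact (hg V _).trans ((congrArg (fun y => τ.hom.app V.left y) (hη_nat f x)).trans
      ((hτ_nat f.left _).trans ((congrArg (fun y => F₁.map ((Over.star S).map f.left) y)
        (hg U x)).symm.trans (hη_nat f _).symm)))
  refine ⟨NatIso.ofComponents (fun U => FintypeCat.equivEquivIso (Equiv.ofBijective _ (hg_bij U)))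
    (fun f => σnat f), ?_⟩
  refine Iso.ext (NatTrans.ext (funext fun A => ?_))
  ext x
  show Classical.choose (hP ((Over.star S).obj A) x) = τ.hom.app A x
  -- the triangle identity `η_{S × A} ≫ (S × pr₂) = 𝟙`
  have e1 : ∀ z : F₁.obj ((Over.star S).obj A),
      F₁.map ((Over.star S).map ((Over.forgetAdjStar S).counit.app A))
        (F₁.map ((Over.forgetAdjStar S).unit.app ((Over.star S).obj A)) z) = z := by
    intro z
    have h0 : F₁.map ((Over.forgetAdjStar S).unit.app ((Over.star S).obj A)) ≫
        F₁.map ((Over.star S).map ((Over.forgetAdjStar S).counit.app A)) = 𝟙 _ :=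
      (F₁.map_comp _ _).symm.trans
        ((congrArg F₁.map ((Over.forgetAdjStar S).right_triangle_components A)).trans (F₁.map_id _))
    exact ConcreteCategory.congr_hom h0 z
  exact (e1 _).symm.trans
    ((congrArg (fun z => F₁.map ((Over.star S).map ((Over.forgetAdjStar S).counit.app A)) z)
      (hg ((Over.star S).obj A) x)).trans
      ((hτ_nat ((Over.forgetAdjStar S).counit.app A) _).symm.trans
        (congrArg (fun z => τ.hom.app A z) (e1 x))))

end Lift


end Literature.AnabelianGeometry.Anabelioids
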